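import Summits.BirchSwinnertonDyer.BirchSwinnertonDyer.Theorems.ResidualThetaTransportAtTwoPlusDualIsoLambdaTwo
import Summits.BirchSwinnertonDyer.BirchSwinnertonDyer.Theorems.ResidualThetaTransportAtTwoRlfTwistedLocalH1Count
import Summits.BirchSwinnertonDyer.BirchSwinnertonDyer.Theorems.ThetaPartnerAtTwoSignedControlAtTwoSignedLocalInjModP
import Literature.NumberTheory.EllipticCurves.ZpExtensionGaloisTwistLocalKummer
import HarnessLib

/-!
# Route `ResidualThetaTransportAtTwo` (RTT P6, item stmt-BirchSwinnertonDyer-23110, road T), H-PLUSDUAL brick (K1a):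
# the class-to-point dictionary of the TWISTED signed local Kummer condition at `2`

Width seat `bsd-wall-tp2-p2x-w2` g15 (cell `bsd-wall`), for the LEAD `bsd-wall-tp2-p2x` g12. HONEST FRAMING: THEOREMS ONLY
(no definition, no named fact, no instance, no `sorry`); closes no item; BSD is NOT proved by any of this.

Setting: `W/ℚ` globally minimal with good supersingular reduction at `2`, `κ` a `ℤ₂`-extension of `ℚ`, `v ∋ 2`, `E = ℚ_v`,
`N = Gal(ℚ̄_v/ℚ_{v,∞}) ≤ Γ_{ℚ_v}` the local subgroup of `ker κ`, `A = ⋃ₙ E⁺(ℚ_{v,n})` (Kobayashi's plus points up the local tower),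
`u` odd, `M_u = E[2^J](χ_u)` the twisted torsion module and `L_u = twistedTorsionLocalKummer 2 κ J u hu ℚ_v A ≤ H¹(ℚ_v, M_u)` the
signed twisted local Kummer condition (D1): the classes `[ψ]` having a WITNESS `(ψ, Q, k)` — `ψ|_N = (τ ↦ τQ − Q)` on points for
some `Q ∈ E(ℚ̄_v)` with `2^k Q ∈ A`. This file is the dictionary `[ψ] ↦ (2^J Q mod 2^J A)` (B. D. Kim 2007, Props. 3.15–3.18 read
at `2`, twisted, level `ℚ_v`); its sequel `…RlfTwistedLocalKummerCard` proves surjectivity onto the eigen-classes and `#L_u = 2^J`.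

## What is proved
* §1 `oneCocycleClass_eq_zero_of_restrict` — generic: a continuous `1`-cocycle whose restriction to a normal subgroup `N` is a
  coboundary is a coboundary, provided the coefficients have no `N`-invariants (inflation–restriction with `H¹(G/N, B^N) = 0`).
* §2 (`g ∈ Γ_{ℚ_v}` a local lift of the topological generator, `u u' ≡ 1 (2^J)`): `twistedTorsion_restrictField_apply_of_mem` /
  `…_of_isTopGenerator` (`N` acts untwisted, `g` acts by `u · res g`), `mem_iSup_signedLocalPoints_of_pow_nsmul_mem` (`A` is
  `2`-saturated in `E(ℚ_{v,∞})`), `nsmul_mem_of_witness` (`2^J Q ∈ A`), `exists_eigen_of_witness` (`g(2^J Q) − u'(2^J Q) ∈ 2^J A`),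
  `sub_mem_of_witness_of_witness` (two witnesses of one class: `2^J Q ≡ 2^J Q' (2^J A)`), `oneCocycleClass_eq_of_witness_sub_mem`
  (conversely congruent witnesses give equal classes — `res_N` is injective by §1 and `E(ℚ_{v,∞})[2] = 0`).

References: B. D. Kim, *The parity conjecture for elliptic curves at supersingular reduction primes*, Compositio Math. 143 (2007),
§3.3 Props. 3.15–3.18 [BDKim2007]; S. Kobayashi, Invent. math. 152 (2003), Def. 1.1, Prop. 8.7, (8.23) [Kobayashi2003]; R. Greenberg,
LNM 1716 (1999), §3 (p. 86), §4 (p. 124) [GreenbergLNM1716]; J.-P. Serre, *Local Fields* VII §5–§6 [SerreLocalFields1979].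
-/

-- the Theorems namespace of this sub repeats the summit name by design (D-0017 nested layout)
set_option linter.dupNamespace false

noncomputable section

open scoped Classical NumberField
open CategoryTheory Function Field NumberField IsDedekindDomain

namespace Summit.BirchSwinnertonDyer.BirchSwinnertonDyer.Theorems.SignedEC.TwistedLocalKummer

open Literature.NumberTheory.EllipticCurves Literature.NumberTheory.GaloisRepresentations WeierstrassCurve ZpExtension
  Literature.NumberTheory.EllipticCurves.Kobayashi2003 Literature.NumberTheory.EllipticCurves.Sprung2012
  Summit.BirchSwinnertonDyer.Rank1Residual.Additive
open scoped ContRepresentation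

universe u

/-! ## §1 Inflation–restriction with trivial invariants: `res_N` is injective on `H¹` -/

/-- **`H¹(G, B) → H¹(N, B)` is injective when `B^N = 0`** (inflation–restriction: the kernel is `H¹(G/N, B^N)`), on cocycles:
if the restriction to the normal subgroup `N` of a continuous crossed homomorphism `ξ : G → B` is the coboundary of `b`, then
`ξ = ∂b` on all of `G` — for `σ ∈ G` the element `ξ(σ) − (σb − b)` is fixed by `N` (compare `ξ(τσ)` and `ξ(σ·σ⁻¹τσ)`), hence `0`.
[cite: SerreLocalFields1979, VII §6 Prop. 4] [cite: GreenbergLNM1716, §3 (p. 86)] -/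
theorem oneCocycleClass_eq_zero_of_restrict {G : Type u} [Group G] [TopologicalSpace G] [IsTopologicalGroup G]
    (T : TopRep.{u} ℤ G) (N : Subgroup G) [N.Normal]
    (hfix : ∀ b : T, (∀ τ : N, T.ρ (τ : G) b = b) → b = 0) (ξ : contOneCocycles T)
    (hξ : ∃ b : T, ∀ τ : N, ξ.1 (τ : G) = T.ρ (τ : G) b - b) : oneCocycleClass T ξ = 0 := by
  obtain ⟨b, hb⟩ := hξ
  rw [oneCocycleClass_eq_zero_iff]
  refine ⟨b, fun σ ↦ ?_⟩
  set d : T := ξ.1 σ - (T.ρ σ b - b) with hd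
  have key : ∀ τ : N, T.ρ (τ : G) d = d := fun τ ↦ by
    have hτ' : σ⁻¹ * (τ : G) * σ ∈ N := conj_mem_of_normal N σ τ
    have e1 : ξ.1 ((τ : G) * σ) = ξ.1 (τ : G) + T.ρ (τ : G) (ξ.1 σ) := ξ.2 (τ : G) σ
    have e2 : ξ.1 (σ * (σ⁻¹ * (τ : G) * σ)) = ξ.1 σ + T.ρ σ (ξ.1 (σ⁻¹ * (τ : G) * σ)) := ξ.2 σ _
    have e3 : σ * (σ⁻¹ * (τ : G) * σ) = (τ : G) * σ := by group
    rw [e3, e1, hb τ, hb ⟨_, hτ'⟩, map_sub, ← ρ_mul_apply, e3, ρ_mul_apply] at e2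
    -- `e2 : ρ τ b - b + ρ τ (ξ σ) = ξ σ + (ρ τ (ρ σ b) - ρ σ b)`
    have e4 : T.ρ (τ : G) (ξ.1 σ) =
        ξ.1 σ + (T.ρ (τ : G) (T.ρ σ b) - T.ρ σ b) - (T.ρ (τ : G) b - b) := by
      rw [← e2]; abel
    rw [hd, map_sub, map_sub, e4]
    abel
  have hd0 : d = 0 := hfix d key
  rw [hd, sub_eq_zero] at hd0
  exact hd0

/-! ## §2 The class-to-point dictionary of the twisted signed local Kummer condition at `2` -/

variable (W : WeierstrassCurve ℚ) [W.IsElliptic] [W.IsGloballyMinimal]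

omit [W.IsElliptic] [W.IsGloballyMinimal] in
/-- On the local subgroup `N = Gal(ℚ̄_v/ℚ_{v,∞})` the twist is invisible: `M_u|_N = E[2^J]|_N`, i.e. `σ ∈ N` acts on
`E[2^J](χ_u)` by `res σ` alone. [cite: GreenbergLNM1716, §4 p. 124] -/
theorem twistedTorsion_restrictField_apply_of_mem (κ : ZpExtension ℚ 2) (J : ℕ) (u : ℤ) (hu : (2 : ℤ) ∣ u - 1)
    (v : HeightOneSpectrum (𝓞 ℚ)) {σ : absoluteGaloisGroup (v.adicCompletion ℚ)}
    (hσ : σ ∈ localSubgroup κ.kerSubgroup (v.adicCompletion ℚ)) (m : W.geomTorsion ((2 ^ J : ℕ) : ℤ)) :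
    (W.twistedTorsionGaloisModule 2 κ J u hu).restrictField (v.adicCompletion ℚ) σ m =
      resGal (K := ℚ) (v.adicCompletion ℚ) σ • m := by
  have hσ' : resGal (K := ℚ) (v.adicCompletion ℚ) σ ∈ κ.kerSubgroup := (mem_localSubgroup_iff _ _ σ).mp hσ
  change W.twistedTorsionGaloisModule 2 κ J u hu (resGal (K := ℚ) (v.adicCompletion ℚ) σ) m = _
  rw [ZpExtension.galoisTwist_apply_apply, torsionGaloisModule_apply_apply,
    ZpExtension.twistExponent_eq_zero_of_mem_kerSubgroup κ hσ', pow_zero, one_smul]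

omit [W.IsElliptic] [W.IsGloballyMinimal] in
/-- A local lift `g` of the topological generator (`κ(res g) = 1`) acts on `E[2^J](χ_u)` by `u · res g`
(at `J = 0` the module is `E[1] = 0`). [cite: GreenbergLNM1716, §4 p. 124] [cite: Washington1997, §13.1] -/
theorem twistedTorsion_restrictField_apply_of_isTopGenerator (κ : ZpExtension ℚ 2) (J : ℕ) (u : ℤ) (hu : (2 : ℤ) ∣ u - 1)
    (v : HeightOneSpectrum (𝓞 ℚ)) {g : absoluteGaloisGroup (v.adicCompletion ℚ)}
    (hg : κ.IsTopGenerator (resGalOfEmb (closureEmb (K := ℚ) (v.adicCompletion ℚ)) g)) (m : W.geomTorsion ((2 ^ J : ℕ) : ℤ)) :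
    (W.twistedTorsionGaloisModule 2 κ J u hu).restrictField (v.adicCompletion ℚ) g m =
      u • (resGal (K := ℚ) (v.adicCompletion ℚ) g • m) := by
  change W.twistedTorsionGaloisModule 2 κ J u hu (resGal (K := ℚ) (v.adicCompletion ℚ) g) m = _
  rw [ZpExtension.galoisTwist_apply_apply, torsionGaloisModule_apply_apply]
  rcases Nat.eq_zero_or_pos J with hJ0 | hJpos
  · subst hJ0
    have hm : m = 0 := Subtype.ext (by
      have h : ((2 ^ 0 : ℕ) : ℤ) • (m : W.geomPoints) = 0 := (Submodule.mem_torsionBy_iff _ _).mp m.2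
      have h1 : ((2 ^ 0 : ℕ) : ℤ) = 1 := by norm_num
      have h2 : (m : W.geomPoints) = 0 := by
        have := h; simp only [h1, one_smul] at this; exact this
      rw [h2, ZeroMemClass.coe_zero])
    rw [hm, smul_zero, smul_zero, smul_zero]
  · have hg' : κ.IsTopGenerator (resGal (K := ℚ) (v.adicCompletion ℚ) g) := by rw [resGal_eq]; exact hg
    rw [ZpExtension.twistExponent_eq_one_of_isTopGenerator κ hJpos hg', pow_one]

/-- **`2`-saturation of `A = ⋃ₙ E⁺(ℚ_{v,n})` in `E(ℚ_{v,∞})`** (no `2`-torsion up the local tower at a good supersingular `2`):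
a tower point `y` with `2^k y ∈ A` lies in `A`. [cite: Kobayashi2003, Def. 1.1, Prop. 8.7] -/
theorem mem_iSup_signedLocalPoints_of_pow_nsmul_mem (hss : Rank1Residual.GoodSS W 2) (κ : ZpExtension ℚ 2)
    (v : HeightOneSpectrum (𝓞 ℚ)) (hv : (2 : 𝓞 ℚ) ∈ v.asIdeal) {k : ℕ} {y : localPoints W (v.adicCompletion ℚ)}
    (hy : y ∈ localTowerPointsOfEmb κ (closureEmb (K := ℚ) (v.adicCompletion ℚ)) W)
    (hky : 2 ^ k • y ∈ ⨆ n, signedLocalPoints κ (v.adicCompletion ℚ) W 1 n) :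
    y ∈ ⨆ n, signedLocalPoints κ (v.adicCompletion ℚ) W 1 n := by
  haveI : Fact (Nat.Prime 2) := ⟨Nat.prime_two⟩
  set ι₀ := closureEmb (K := ℚ) (v.adicCompletion ℚ) with hι₀
  have hnt : ∀ P ∈ localTowerPointsOfEmb κ ι₀ W, 2 • P = 0 → P = 0 := fun P hP h2 ↦
    SSFlatEC.eq_zero_of_mem_localTowerPointsOfEmb_of_two_nsmul W hss κ (by exact_mod_cast hv) ι₀ hP h2
  obtain ⟨n, hn⟩ := (AddSubgroup.mem_iSup_of_directed (signedLocalPointsOfEmb_mono κ ι₀ W 1).directed_le).1 hky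
  exact le_iSup (fun m ↦ signedLocalPoints κ (v.adicCompletion ℚ) W 1 m) n
    (SignedEC.mem_signedLocalPointsOfEmb_of_pow_nsmul_mem W κ ι₀ hnt 1 n hy hn)


/-- **(T1) `2^J Q ∈ A` for every witness `(ψ, Q, k)` of a class of `L_u`.** On `N` the values `ψ(τ) ↦ τQ − Q` are
`2^J`-torsion, so `2^J Q ∈ E(ℚ_{v,∞})`; and `2^k (2^J Q) ∈ A`, so `2^J Q ∈ A` by saturation. [cite: Kobayashi2003, Def. 1.1, Prop. 8.7] -/
theorem nsmul_mem_of_witness (hss : Rank1Residual.GoodSS W 2) (κ : ZpExtension ℚ 2) (J : ℕ) (u : ℤ) (hu : (2 : ℤ) ∣ u - 1)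
    (v : HeightOneSpectrum (𝓞 ℚ)) (hv : (2 : 𝓞 ℚ) ∈ v.asIdeal)
    (ψ : contOneCocycles ((W.twistedTorsionGaloisModule 2 κ J u hu).restrictField (v.adicCompletion ℚ)).toTopRep)
    (Q : localPoints W (v.adicCompletion ℚ)) {k : ℕ}
    (hkQ : 2 ^ k • Q ∈ ⨆ n, signedLocalPoints κ (v.adicCompletion ℚ) W 1 n)
    (hψ : ∀ τ : localSubgroup κ.kerSubgroup (v.adicCompletion ℚ),
      pointsMap W (v.adicCompletion ℚ)
          ((ψ.1 (τ : absoluteGaloisGroup (v.adicCompletion ℚ)) : W.geomTorsion ((2 ^ J : ℕ) : ℤ)) : W.geomPoints) =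
        (τ : absoluteGaloisGroup (v.adicCompletion ℚ)) • Q - Q) :
    2 ^ J • Q ∈ ⨆ n, signedLocalPoints κ (v.adicCompletion ℚ) W 1 n := by
  have galois_smul_nsmul : ∀ (τ : absoluteGaloisGroup (v.adicCompletion ℚ)) (n : ℕ) (P : localPoints W (v.adicCompletion ℚ)),
      τ • (n • P) = n • (τ • P) := fun τ n P ↦ map_nsmul (DistribSMul.toAddMonoidHom _ τ) n P
  have htower : 2 ^ J • Q ∈ localTowerPointsOfEmb κ (closureEmb (K := ℚ) (v.adicCompletion ℚ)) W := by
    rw [mem_localTowerPointsOfEmb_iff]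
    intro τ hτ
    have h := hψ ⟨τ, hτ⟩
    have h2 : 2 ^ J • ((τ • Q) - Q) = 0 := by
      rw [← h, ← map_nsmul, ← AddSubgroupClass.coe_nsmul, W.pow_nsmul_geomTorsion_pow 2 J, ZeroMemClass.coe_zero, map_zero]
    rw [smul_sub, ← galois_smul_nsmul, sub_eq_zero] at h2
    exact h2
  refine mem_iSup_signedLocalPoints_of_pow_nsmul_mem W hss κ v hv htower (k := k) ?_
  rw [smul_comm]
  exact AddSubgroup.nsmul_mem _ hkQ _

/-- **(T2) the eigen-relation of the point of a witness**: for a local lift `g` of the topological generator and `u u' ≡ 1 (2^J)`,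
the point `a = 2^J Q` of a witness `(ψ, Q, k)` of a class of `L_u` satisfies `g a − u' a ∈ 2^J A`. (The cocycle identity at
`(g, τ)` and `(gτg⁻¹, g)` shows that `u·gQ − Q − ι ψ(g)` is fixed by `N`; multiply by `2^J` and saturate.)
[cite: BDKim2007, Prop. 3.18] [cite: GreenbergLNM1716, §4 p. 124] -/
theorem exists_eigen_of_witness (hss : Rank1Residual.GoodSS W 2) (κ : ZpExtension ℚ 2) (J : ℕ) {u u' : ℤ}
    (hu : (2 : ℤ) ∣ u - 1) (huu' : ((2 : ℤ) ^ J) ∣ u * u' - 1)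
    (v : HeightOneSpectrum (𝓞 ℚ)) (hv : (2 : 𝓞 ℚ) ∈ v.asIdeal) {g : absoluteGaloisGroup (v.adicCompletion ℚ)}
    (hg : κ.IsTopGenerator (resGalOfEmb (closureEmb (K := ℚ) (v.adicCompletion ℚ)) g))
    (ψ : contOneCocycles ((W.twistedTorsionGaloisModule 2 κ J u hu).restrictField (v.adicCompletion ℚ)).toTopRep)
    (Q : localPoints W (v.adicCompletion ℚ)) {k : ℕ}
    (hkQ : 2 ^ k • Q ∈ ⨆ n, signedLocalPoints κ (v.adicCompletion ℚ) W 1 n)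
    (hψ : ∀ τ : localSubgroup κ.kerSubgroup (v.adicCompletion ℚ),
      pointsMap W (v.adicCompletion ℚ)
          ((ψ.1 (τ : absoluteGaloisGroup (v.adicCompletion ℚ)) : W.geomTorsion ((2 ^ J : ℕ) : ℤ)) : W.geomPoints) =
        (τ : absoluteGaloisGroup (v.adicCompletion ℚ)) • Q - Q) :
    ∃ w ∈ (⨆ n, signedLocalPoints κ (v.adicCompletion ℚ) W 1 n),
      g • (2 ^ J • Q) - u' • (2 ^ J • Q) = 2 ^ J • w := by
  haveI : Fact (Nat.Prime 2) := ⟨Nat.prime_two⟩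
  let G := absoluteGaloisGroup (v.adicCompletion ℚ)
  let Pt := localPoints W (v.adicCompletion ℚ)
  let N : Subgroup G := localSubgroup κ.kerSubgroup (v.adicCompletion ℚ)
  set A : AddSubgroup Pt := ⨆ n, signedLocalPoints κ (v.adicCompletion ℚ) W 1 n with hAdef
  let B := W.geomTorsion ((2 ^ J : ℕ) : ℤ)
  let X : ContinuousRep G ℤ B := (W.twistedTorsionGaloisModule 2 κ J u hu).restrictField (v.adicCompletion ℚ)
  let ι : B → Pt := fun b ↦ pointsMap W (v.adicCompletion ℚ) (b : W.geomPoints)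
  have galois_smul_nsmul : ∀ (τ : G) (n : ℕ) (P : Pt), τ • (n • P) = n • (τ • P) :=
    fun τ n P ↦ map_nsmul (DistribSMul.toAddMonoidHom Pt τ) n P
  have galois_smul_zsmul : ∀ (τ : G) (n : ℤ) (P : Pt), τ • (n • P) = n • (τ • P) :=
    fun τ n P ↦ map_zsmul (DistribSMul.toAddMonoidHom Pt τ) n P
  have hιadd : ∀ a b : B, ι (a + b) = ι a + ι b := fun a b ↦ by
    change pointsMap W _ ((a : W.geomPoints) + b) = _; rw [map_add]
  have hιzsmul : ∀ (c : ℤ) (a : B), ι (c • a) = c • ι a := fun c a ↦ by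
    change pointsMap W _ (((c • a : B) : W.geomPoints)) = _
    rw [AddSubgroupClass.coe_zsmul, map_zsmul]
  have hιnsmul : ∀ (c : ℕ) (a : B), ι (c • a) = c • ι a := fun c a ↦ by
    change pointsMap W _ (((c • a : B) : W.geomPoints)) = _
    rw [AddSubgroupClass.coe_nsmul, map_nsmul]
  have hιgal : ∀ (σ : G) (a : B), ι (resGal (K := ℚ) (v.adicCompletion ℚ) σ • a) = σ • ι a := fun σ a ↦ by
    change pointsMap W _ (((resGal (K := ℚ) (v.adicCompletion ℚ) σ • a : B) : W.geomPoints)) = _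
    rw [Literature.NumberTheory.EllipticCurves.AddSubgroup.torsionBy.coe_smul, pointsMap_smul]
  have hιJ : ∀ b : B, 2 ^ J • ι b = 0 := fun b ↦ by
    rw [← hιnsmul, W.pow_nsmul_geomTorsion_pow 2 J b]
    change pointsMap W _ ((0 : B) : W.geomPoints) = 0
    rw [ZeroMemClass.coe_zero, map_zero]
  have hψN : ∀ τ : N, ι (ψ.1 (τ : G)) = (τ : G) • Q - Q := hψ
  have hXN : ∀ {σ : G}, σ ∈ N → ∀ m : B, X σ m = resGal (K := ℚ) (v.adicCompletion ℚ) σ • m :=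
    fun hσ m ↦ twistedTorsion_restrictField_apply_of_mem W κ J u hu v hσ m
  have hXg : ∀ m : B, X g m = u • (resGal (K := ℚ) (v.adicCompletion ℚ) g • m) :=
    fun m ↦ twistedTorsion_restrictField_apply_of_isTopGenerator W κ J u hu v hg m
  set c : Pt := ι (ψ.1 g) with hc
  -- `D := u·gQ − Q − c` is fixed by `N`
  have hfixD : ∀ τ : G, τ ∈ N → τ • (u • (g • Q) - Q - c) = u • (g • Q) - Q - c := by
    intro τ' hτ'
    have hτ : g⁻¹ * τ' * g ∈ N := conj_mem_of_normal N g ⟨τ', hτ'⟩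
    have e1 : ψ.1 (g * (g⁻¹ * τ' * g)) = ψ.1 g + X g (ψ.1 (g⁻¹ * τ' * g)) := ψ.2 g _
    have e2 : ψ.1 (τ' * g) = ψ.1 τ' + X τ' (ψ.1 g) := ψ.2 τ' g
    have e3 : g * (g⁻¹ * τ' * g) = τ' * g := by group
    rw [e3, e2] at e1
    have e4 := congrArg ι e1
    rw [hιadd, hιadd, hXN hτ', hιgal, hXg, hιzsmul, hιgal, hψN ⟨τ', hτ'⟩, hψN ⟨_, hτ⟩, smul_sub g,
      ← hc] at e4
    have e5 : g • ((g⁻¹ * τ' * g) • Q) = τ' • g • Q := by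
      rw [← mul_smul, ← mul_assoc, ← mul_assoc, mul_inv_cancel, one_mul, mul_smul]
    rw [e5] at e4
    -- `e4 : τ' • Q - Q + τ' • c = c + u • (τ' • g • Q - g • Q)`
    have e6 : u • (τ' • g • Q) = (τ' • Q - Q + τ' • c) - c + u • (g • Q) := by
      rw [smul_sub] at e4
      calc u • (τ' • g • Q) = (c + (u • (τ' • g • Q) - u • (g • Q))) - c + u • (g • Q) := by abel
        _ = (τ' • Q - Q + τ' • c) - c + u • (g • Q) := by rw [← e4]
    rw [smul_sub, smul_sub, galois_smul_zsmul, e6]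
    abel
  have hDtower : u • (g • Q) - Q - c ∈ localTowerPointsOfEmb κ (closureEmb (K := ℚ) (v.adicCompletion ℚ)) W :=
    (mem_localTowerPointsOfEmb_iff κ _ W _).2 hfixD
  -- `a := 2^J Q ∈ A`, `2^J D = u·g a − a ∈ A`, so `D ∈ A`
  have ha : 2 ^ J • Q ∈ A := nsmul_mem_of_witness W hss κ J u hu v hv ψ Q hkQ hψ
  have hga : g • (2 ^ J • Q) ∈ A := PlusDualTwo.smul_mem_iSup_signedLocalPoints W κ v g ha
  have h2D : 2 ^ J • (u • (g • Q) - Q - c) = u • (g • (2 ^ J • Q)) - 2 ^ J • Q := by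
    rw [smul_sub, smul_sub, hc, hιJ, sub_zero, smul_comm (2 ^ J) u, galois_smul_nsmul]
  have hDA : u • (g • Q) - Q - c ∈ A := by
    refine mem_iSup_signedLocalPoints_of_pow_nsmul_mem W hss κ v hv hDtower (k := J) ?_
    rw [h2D]
    exact sub_mem (A.zsmul_mem hga u) ha
  -- rewrite with the inverse twist `u'`
  obtain ⟨m, hm⟩ := huu'
  have h2J : ∀ P : Pt, ((2 : ℤ) ^ J) • P = 2 ^ J • P := fun P ↦ by
    rw [show ((2 : ℤ) ^ J) = ((2 ^ J : ℕ) : ℤ) by push_cast; rfl, natCast_zsmul]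
  refine ⟨u' • (u • (g • Q) - Q - c) - m • (g • (2 ^ J • Q)), sub_mem (A.zsmul_mem hDA u') (A.zsmul_mem hga m), ?_⟩
  set ga : Pt := g • (2 ^ J • Q) with hga'
  set a : Pt := 2 ^ J • Q with ha'
  have euu : (u' * u) • ga = ga + ((2 : ℤ) ^ J * m) • ga := by
    rw [show u' * u = 1 + (2 : ℤ) ^ J * m by linear_combination hm, add_smul, one_smul]
  rw [smul_sub (2 ^ J), smul_comm (2 ^ J) u', h2D, smul_sub u', smul_smul, euu, mul_smul, h2J]
  abel

/-- **(T3) two witnesses of ONE class have congruent points**: if `(ψ, Q, k)` and `(ψ', Q', k')` witness the same class of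
`L_u` then `2^J Q − 2^J Q' ∈ 2^J A` (`ψ − ψ' = ∂b`, so `Q − Q' − ι b ∈ E(ℚ_{v,∞})`; multiply by `2^J` and saturate).
[cite: BDKim2007, Prop. 3.18] [cite: Kobayashi2003, Def. 1.1] -/
theorem sub_mem_of_witness_of_witness (hss : Rank1Residual.GoodSS W 2) (κ : ZpExtension ℚ 2) (J : ℕ) (u : ℤ)
    (hu : (2 : ℤ) ∣ u - 1) (v : HeightOneSpectrum (𝓞 ℚ)) (hv : (2 : 𝓞 ℚ) ∈ v.asIdeal)
    (ψ ψ' : contOneCocycles ((W.twistedTorsionGaloisModule 2 κ J u hu).restrictField (v.adicCompletion ℚ)).toTopRep)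
    (Q Q' : localPoints W (v.adicCompletion ℚ)) {k k' : ℕ}
    (hkQ : 2 ^ k • Q ∈ ⨆ n, signedLocalPoints κ (v.adicCompletion ℚ) W 1 n)
    (hkQ' : 2 ^ k' • Q' ∈ ⨆ n, signedLocalPoints κ (v.adicCompletion ℚ) W 1 n)
    (hψ : ∀ τ : localSubgroup κ.kerSubgroup (v.adicCompletion ℚ),
      pointsMap W (v.adicCompletion ℚ)
          ((ψ.1 (τ : absoluteGaloisGroup (v.adicCompletion ℚ)) : W.geomTorsion ((2 ^ J : ℕ) : ℤ)) : W.geomPoints) =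
        (τ : absoluteGaloisGroup (v.adicCompletion ℚ)) • Q - Q)
    (hψ' : ∀ τ : localSubgroup κ.kerSubgroup (v.adicCompletion ℚ),
      pointsMap W (v.adicCompletion ℚ)
          ((ψ'.1 (τ : absoluteGaloisGroup (v.adicCompletion ℚ)) : W.geomTorsion ((2 ^ J : ℕ) : ℤ)) : W.geomPoints) =
        (τ : absoluteGaloisGroup (v.adicCompletion ℚ)) • Q' - Q')
    (heq : oneCocycleClass _ ψ = oneCocycleClass _ ψ') :
    ∃ w ∈ (⨆ n, signedLocalPoints κ (v.adicCompletion ℚ) W 1 n), 2 ^ J • Q - 2 ^ J • Q' = 2 ^ J • w := by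
  haveI : Fact (Nat.Prime 2) := ⟨Nat.prime_two⟩
  let G := absoluteGaloisGroup (v.adicCompletion ℚ)
  let Pt := localPoints W (v.adicCompletion ℚ)
  let N : Subgroup G := localSubgroup κ.kerSubgroup (v.adicCompletion ℚ)
  set A : AddSubgroup Pt := ⨆ n, signedLocalPoints κ (v.adicCompletion ℚ) W 1 n with hAdef
  let B := W.geomTorsion ((2 ^ J : ℕ) : ℤ)
  let X : ContinuousRep G ℤ B := (W.twistedTorsionGaloisModule 2 κ J u hu).restrictField (v.adicCompletion ℚ)
  let ι : B → Pt := fun b ↦ pointsMap W (v.adicCompletion ℚ) (b : W.geomPoints)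
  have hιsub : ∀ a b : B, ι (a - b) = ι a - ι b := fun a b ↦ by
    change pointsMap W _ ((a : W.geomPoints) - b) = _; rw [map_sub]
  have hιnsmul : ∀ (c : ℕ) (a : B), ι (c • a) = c • ι a := fun c a ↦ by
    change pointsMap W _ (((c • a : B) : W.geomPoints)) = _
    rw [AddSubgroupClass.coe_nsmul, map_nsmul]
  have hιgal : ∀ (σ : G) (a : B), ι (resGal (K := ℚ) (v.adicCompletion ℚ) σ • a) = σ • ι a := fun σ a ↦ by
    change pointsMap W _ (((resGal (K := ℚ) (v.adicCompletion ℚ) σ • a : B) : W.geomPoints)) = _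
    rw [Literature.NumberTheory.EllipticCurves.AddSubgroup.torsionBy.coe_smul, pointsMap_smul]
  have hιJ : ∀ b : B, 2 ^ J • ι b = 0 := fun b ↦ by
    rw [← hιnsmul, W.pow_nsmul_geomTorsion_pow 2 J b]
    change pointsMap W _ ((0 : B) : W.geomPoints) = 0
    rw [ZeroMemClass.coe_zero, map_zero]
  have hXN : ∀ {σ : G}, σ ∈ N → ∀ m : B, X σ m = resGal (K := ℚ) (v.adicCompletion ℚ) σ • m :=
    fun hσ m ↦ twistedTorsion_restrictField_apply_of_mem W κ J u hu v hσ m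
  have hψN : ∀ τ : N, ι (ψ.1 (τ : G)) = (τ : G) • Q - Q := hψ
  have hψ'N : ∀ τ : N, ι (ψ'.1 (τ : G)) = (τ : G) • Q' - Q' := hψ'
  -- `ψ − ψ' = ∂b`
  have h0 : oneCocycleClass _ (ψ - ψ') = 0 := by rw [oneCocycleClass_sub, heq, sub_self]
  rw [oneCocycleClass_eq_zero_iff] at h0
  obtain ⟨b, hb⟩ := h0
  -- `D := Q − Q' − ι b` is fixed by `N`
  have hD : Q - Q' - ι b ∈ localTowerPointsOfEmb κ (closureEmb (K := ℚ) (v.adicCompletion ℚ)) W := by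
    rw [mem_localTowerPointsOfEmb_iff]
    intro τ hτ
    have h := congrArg ι (hb τ)
    rw [Submodule.coe_sub, ContinuousMap.sub_apply, hιsub, hψN ⟨τ, hτ⟩, hψ'N ⟨τ, hτ⟩, hιsub] at h
    change _ = ι (X τ b) - ι b at h
    rw [hXN hτ, hιgal] at h
    -- `h : (τ•Q − Q) − (τ•Q' − Q') = τ • ι b − ι b`
    rw [smul_sub, smul_sub]
    calc τ • Q - τ • Q' - τ • ι b = (τ • Q - Q) - (τ • Q' - Q') - (τ • ι b - ι b) + (Q - Q' - ι b) := by abel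
      _ = Q - Q' - ι b := by rw [h]; abel
  have h2D : 2 ^ J • (Q - Q' - ι b) = 2 ^ J • Q - 2 ^ J • Q' := by
    rw [smul_sub, smul_sub, hιJ, sub_zero]
  refine ⟨Q - Q' - ι b, mem_iSup_signedLocalPoints_of_pow_nsmul_mem W hss κ v hv hD (k := J) ?_, h2D.symm⟩
  rw [h2D]
  exact sub_mem (nsmul_mem_of_witness W hss κ J u hu v hv ψ Q hkQ hψ) (nsmul_mem_of_witness W hss κ J u hu v hv ψ' Q' hkQ' hψ')

/-- **(T4) congruent points give ONE class** (`res_N : H¹(ℚ_v, M_u) → H¹(N, M_u)` is injective — §1 with `E[2^J]^N = 0`,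
`TwistedLocalCount.geomTorsion_eq_zero_of_forall_local_kerSubgroup_smul_eq`): if `(ψ, Q, k)`, `(ψ', Q', k')` are witnesses with
`2^J Q − 2^J Q' ∈ 2^J A` then `[ψ] = [ψ']`. [cite: BDKim2007, Prop. 3.18] [cite: GreenbergLNM1716, §3 p. 86] -/
theorem oneCocycleClass_eq_of_witness_sub_mem (hss : Rank1Residual.GoodSS W 2) (κ : ZpExtension ℚ 2) (J : ℕ) (u : ℤ)
    (hu : (2 : ℤ) ∣ u - 1) (v : HeightOneSpectrum (𝓞 ℚ)) (hv : (2 : 𝓞 ℚ) ∈ v.asIdeal)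
    (ψ ψ' : contOneCocycles ((W.twistedTorsionGaloisModule 2 κ J u hu).restrictField (v.adicCompletion ℚ)).toTopRep)
    (Q Q' : localPoints W (v.adicCompletion ℚ))
    (hψ : ∀ τ : localSubgroup κ.kerSubgroup (v.adicCompletion ℚ),
      pointsMap W (v.adicCompletion ℚ)
          ((ψ.1 (τ : absoluteGaloisGroup (v.adicCompletion ℚ)) : W.geomTorsion ((2 ^ J : ℕ) : ℤ)) : W.geomPoints) =
        (τ : absoluteGaloisGroup (v.adicCompletion ℚ)) • Q - Q)
    (hψ' : ∀ τ : localSubgroup κ.kerSubgroup (v.adicCompletion ℚ),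
      pointsMap W (v.adicCompletion ℚ)
          ((ψ'.1 (τ : absoluteGaloisGroup (v.adicCompletion ℚ)) : W.geomTorsion ((2 ^ J : ℕ) : ℤ)) : W.geomPoints) =
        (τ : absoluteGaloisGroup (v.adicCompletion ℚ)) • Q' - Q')
    (hQQ' : ∃ w ∈ (⨆ n, signedLocalPoints κ (v.adicCompletion ℚ) W 1 n), 2 ^ J • Q - 2 ^ J • Q' = 2 ^ J • w) :
    oneCocycleClass _ ψ = oneCocycleClass _ ψ' := by
  haveI : Fact (Nat.Prime 2) := ⟨Nat.prime_two⟩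
  let G := absoluteGaloisGroup (v.adicCompletion ℚ)
  let Pt := localPoints W (v.adicCompletion ℚ)
  let N : Subgroup G := localSubgroup κ.kerSubgroup (v.adicCompletion ℚ)
  set A : AddSubgroup Pt := ⨆ n, signedLocalPoints κ (v.adicCompletion ℚ) W 1 n with hAdef
  let n : ℤ := ((2 ^ J : ℕ) : ℤ)
  have hn : n ≠ 0 := by
    change ((2 ^ J : ℕ) : ℤ) ≠ 0
    exact_mod_cast pow_ne_zero J two_ne_zero
  let B := W.geomTorsion n
  let X : ContinuousRep G ℤ B := (W.twistedTorsionGaloisModule 2 κ J u hu).restrictField (v.adicCompletion ℚ)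
  let ι : B → Pt := fun b ↦ pointsMap W (v.adicCompletion ℚ) (b : W.geomPoints)
  let θ : B ≃+ AddSubgroup.torsionBy Pt n := W.torsionPointsEquiv n (E := v.adicCompletion ℚ) hn
  have hιinj : Function.Injective ι := fun a b hab ↦ θ.injective (Subtype.ext hab)
  have hιsub : ∀ a b : B, ι (a - b) = ι a - ι b := fun a b ↦ by
    change pointsMap W _ ((a : W.geomPoints) - b) = _; rw [map_sub]
  have hιgal : ∀ (σ : G) (a : B), ι (resGal (K := ℚ) (v.adicCompletion ℚ) σ • a) = σ • ι a := fun σ a ↦ by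
    change pointsMap W _ (((resGal (K := ℚ) (v.adicCompletion ℚ) σ • a : B) : W.geomPoints)) = _
    rw [Literature.NumberTheory.EllipticCurves.AddSubgroup.torsionBy.coe_smul, pointsMap_smul]
  have hXN : ∀ {σ : G}, σ ∈ N → ∀ m : B, X σ m = resGal (K := ℚ) (v.adicCompletion ℚ) σ • m :=
    fun hσ m ↦ twistedTorsion_restrictField_apply_of_mem W κ J u hu v hσ m
  have hAtower : A ≤ localTowerPointsOfEmb κ (closureEmb (K := ℚ) (v.adicCompletion ℚ)) W :=
    PlusDualTwo.iSup_signedLocalPoints_le_localTowerPointsOfEmb W κ v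
  -- no `N`-invariants in `E[2^J]`
  have hfixB : ∀ b : B, (∀ τ : N, X.toTopRep.ρ (τ : G) b = b) → b = 0 := by
    intro b hb
    refine TwistedLocalCount.geomTorsion_eq_zero_of_forall_local_kerSubgroup_smul_eq W hss κ J hv b fun τ hτ ↦ ?_
    have h := hb ⟨τ, hτ⟩
    change X τ b = b at h
    rwa [hXN hτ] at h
  have hψN : ∀ τ : N, ι (ψ.1 (τ : G)) = (τ : G) • Q - Q := hψ
  have hψ'N : ∀ τ : N, ι (ψ'.1 (τ : G)) = (τ : G) • Q' - Q' := hψ'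
  obtain ⟨w, hw, hwe⟩ := hQQ'
  have hT : Q - Q' - w ∈ AddSubgroup.torsionBy Pt n := by
    refine (Submodule.mem_torsionBy_iff _ _).mpr ?_
    change ((2 ^ J : ℕ) : ℤ) • (Q - Q' - w) = 0
    rw [natCast_zsmul, smul_sub, smul_sub, hwe, sub_self]
  let bT : B := θ.symm ⟨Q - Q' - w, hT⟩
  have hιbT : ι bT = Q - Q' - w := W.pointsMap_torsionPointsEquiv_symm n hn ⟨Q - Q' - w, hT⟩
  have hwN : ∀ τ : G, τ ∈ N → τ • w = w := (mem_localTowerPointsOfEmb_iff κ _ W w).1 (hAtower hw)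
  rw [← sub_eq_zero, ← oneCocycleClass_sub]
  refine oneCocycleClass_eq_zero_of_restrict X.toTopRep N hfixB (ψ - ψ') ⟨bT, fun τ ↦ ?_⟩
  apply hιinj
  change ι (ψ.1 (τ : G) - ψ'.1 (τ : G)) = ι (X (τ : G) bT - bT)
  rw [hιsub, hιsub, hψN τ, hψ'N τ, hXN τ.2, hιgal, hιbT, smul_sub, smul_sub, hwN _ τ.2]
  abel

end Summit.BirchSwinnertonDyer.BirchSwinnertonDyer.Theorems.SignedEC.TwistedLocalKummer

end
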